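import Mathlib
import Summits.Ventures.PercRepro2.HCov
import Summits.Ventures.PercRepro2.HCovSwap
import Summits.Ventures.PercRepro2.ContractDefs
import Summits.Ventures.PercRepro2.RECMReduction
import Summits.Ventures.PercRepro2.GcTransport
import Summits.Ventures.PercRepro2.LeafLinearity
import Summits.Ventures.PercRepro2.LeafDelete
import Summits.Ventures.PercRepro2.RootCoincidence
import Summits.Ventures.PercRepro2.A3Coincidence
import Summits.Ventures.PercRepro2.DiagBA3
import Summits.Ventures.PercRepro2.PendantOB
import Summits.Ventures.PercRepro2.PendantBO
import Summits.Ventures.PercRepro2.PendantRootAll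
import Summits.Ventures.PercRepro2.PendantRootReduction
import Summits.Ventures.PercRepro2.LeafMarkReduction

/-!
# Leaves among `a₁, a₂, o, b` at ANY vertex, and the leaf reduction in its final form
(blind cell PercRepro2, p5 g24; `proofs/P5-OEDGE.md` §30 addendum 2)

A leaf among the four marks `a₁, a₂, o, b` attached to a MARK is (HCOV) outright:

* a root leaf at a mark `y ∈ {o, a₁, a₃, b}`: the contraction `p[e ↦ 1]` transports (`Gc_transport`,
  `conn_update_true_iff_contract`) to the degenerate marking with `y` merged into the root, where
  `Gc = 0` (`RootCoincidence.Gc_o_eq_a1`, `Gc_b_eq_a1`, `Gc_a2_eq_a1`, `A3Coincidence.Gc_a3_eq_a2`, with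
  `Gc_swap`), so `HCov_pendant_root_all` applies with a trivial hypothesis
  (**`HCov_root_leaf_at_mark`**, and the mirror at `a₁`);
* `o` a leaf at a mark: at a root `Gc = 0` (`RootCoincidence.Gc_o_leaf_at_root`), at `a₃` `Gc = 0`
  (`LeafLinearity.Gc_leaf_o` + `A3Coincidence.Gc_a3_eq_o`), at `b` the diagonal theorem
  (`PendantOB.HCov_pendant_o_at_b`) — **`HCov_o_leaf_at_mark`**;
* `b` a leaf at a mark: at a root `Gc = 0` (`Gc_b_leaf_at_root`), at `o` (`PendantBO.HCov_pendant_b_at_o`),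
  at `a₃` (`DiagBA3.HCov_pendant_b_at_a3`) — **`HCov_b_leaf_at_mark`**.

Hence **`HCov_leaf_mark_any`**: any of `a₁, a₂, o, b` a leaf at any vertex `y` — (HCOV) from (HCOV) on the
smaller graph when `y` is unmarked (`LeafMarkReduction`), outright when `y` is a mark; the class
**`NoLeafMark`** (none of `a₁, a₂, o, b` has degree one) and **`HCov_all_of_noLeafMark : HCovNLM_all → HCov_all`**:
a minimal counterexample to (HCOV) has each of `a₁, a₂, o, b` of degree ≠ 1.  The leaf `a₃` at an
unmarked vertex remains the open row (LEAF-½).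
-/

namespace Summit.Ventures.PercRepro2

open CovForm CovForm.FirstOrder RECM LeafRoot LeafMark Contract

namespace LeafMarkAny

section Roots

variable {V : Type*} {E : Type*} [Fintype E] [DecidableEq E] [Fintype V] [DecidableEq V]
  {R : Type*} [Field R] [LinearOrder R] [IsStrictOrderedRing R]

omit [Fintype V] [LinearOrder R] [IsStrictOrderedRing R] in
/-- The contraction of a pendant root edge `e = {a₂, y}` transports `Gc` at the open pin to the
degenerate marking with `y` merged into `a₂`. -/
lemma Gc_update_one_eq_contract_marks (p : E → R) {ends : E → Sym2 V} {e : E} {a₂ y : V}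
    (hends : ends e = s(a₂, y)) (o a₁ a₃ b : V) :
    Gc (Function.update p e 1) ends o a₁ a₂ a₃ b =
      Gc p (contractRootEdge ends a₂ y) (contractMap {a₂, y} a₂ o) (contractMap {a₂, y} a₂ a₁)
        (contractMap {a₂, y} a₂ a₂) (contractMap {a₂, y} a₂ a₃) (contractMap {a₂, y} a₂ b) :=
  Gc_transport (φ := contractMap {a₂, y} a₂) (prob_update_one_eq_preimage p e)
    (fun ω x z => conn_update_true_iff_contract hends ω x z) o a₁ a₂ a₃ b

/-- **A root leaf at a mark**: `a₂` a leaf whose only edge `e = {a₂, y}` goes to a mark `y ∈ {o, a₁, a₃, b}`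
gives (HCOV) outright — the contraction is a vanishing degenerate marking. -/
theorem HCov_root_leaf_at_mark (p : E → R) (hp : IsProbVec p) {ends : E → Sym2 V} {e : E}
    {o a₁ a₂ a₃ b y : V} (hends : ends e = s(a₂, y)) (hleaf : ∀ f, a₂ ∈ ends f → f = e)
    (hy : y = o ∨ y = a₁ ∨ y = a₃ ∨ y = b) (ho : o ≠ a₂) (h1 : a₁ ≠ a₂) (h3 : a₃ ≠ a₂) (hb : b ≠ a₂)
    (h13 : a₁ ≠ a₃) (ho1 : o ≠ a₁) (ho3 : o ≠ a₃) (hob : o ≠ b) (hb1 : b ≠ a₁) (hb3 : b ≠ a₃) :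
    HCov p ends o a₁ a₂ a₃ b := by
  apply HCov_pendant_root_all hp hleaf hends ho h1 h3 hb
  unfold HCov
  rw [Gc_update_one_eq_contract_marks p hends o a₁ a₃ b, contractMap_of_mem (Finset.mem_insert_self a₂ {y})]
  rcases hy with hy | hy | hy | hy
  · -- `y = o`: the marking `(a₂, a₁, a₂, a₃, b)`
    rw [contractMap_of_mem (by simp [hy] : o ∈ ({a₂, y} : Finset V)),
      contractMap_of_notMem (by simp [hy, h1, ho1.symm] : a₁ ∉ ({a₂, y} : Finset V)),
      contractMap_of_notMem (by simp [hy, h3, ho3.symm] : a₃ ∉ ({a₂, y} : Finset V)),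
      contractMap_of_notMem (by simp [hy, hb, hob.symm] : b ∉ ({a₂, y} : Finset V)),
      Gc_swap, RootCoincidence.Gc_o_eq_a1]
  · -- `y = a₁`: the marking `(o, a₂, a₂, a₃, b)`
    rw [contractMap_of_notMem (by simp [hy, ho, ho1] : o ∉ ({a₂, y} : Finset V)),
      contractMap_of_mem (by simp [hy] : a₁ ∈ ({a₂, y} : Finset V)),
      contractMap_of_notMem (by simp [hy, h3, h13.symm] : a₃ ∉ ({a₂, y} : Finset V)),
      contractMap_of_notMem (by simp [hy, hb, hb1] : b ∉ ({a₂, y} : Finset V)),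
      RootCoincidence.Gc_a2_eq_a1]
  · -- `y = a₃`: the marking `(o, a₁, a₂, a₂, b)`
    rw [contractMap_of_notMem (by simp [hy, ho, ho3] : o ∉ ({a₂, y} : Finset V)),
      contractMap_of_notMem (by simp [hy, h1, h13] : a₁ ∉ ({a₂, y} : Finset V)),
      contractMap_of_mem (by simp [hy] : a₃ ∈ ({a₂, y} : Finset V)),
      contractMap_of_notMem (by simp [hy, hb, hb3] : b ∉ ({a₂, y} : Finset V)),
      A3Coincidence.Gc_a3_eq_a2]
  · -- `y = b`: the marking `(o, a₁, a₂, a₃, a₂)`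
    rw [contractMap_of_notMem (by simp [hy, ho, hob] : o ∉ ({a₂, y} : Finset V)),
      contractMap_of_notMem (by simp [hy, h1, hb1.symm] : a₁ ∉ ({a₂, y} : Finset V)),
      contractMap_of_notMem (by simp [hy, h3, hb3.symm] : a₃ ∉ ({a₂, y} : Finset V)),
      contractMap_of_mem (by simp [hy] : b ∈ ({a₂, y} : Finset V)),
      Gc_swap, RootCoincidence.Gc_b_eq_a1]

/-- The mirror: `a₁` a leaf at a mark `y ∈ {o, a₂, a₃, b}`. -/
theorem HCov_root_leaf_at_mark' (p : E → R) (hp : IsProbVec p) {ends : E → Sym2 V} {e : E}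
    {o a₁ a₂ a₃ b y : V} (hends : ends e = s(a₁, y)) (hleaf : ∀ f, a₁ ∈ ends f → f = e)
    (hy : y = o ∨ y = a₂ ∨ y = a₃ ∨ y = b) (ho : o ≠ a₁) (h2 : a₂ ≠ a₁) (h3 : a₃ ≠ a₁) (hb : b ≠ a₁)
    (h23 : a₂ ≠ a₃) (ho2 : o ≠ a₂) (ho3 : o ≠ a₃) (hob : o ≠ b) (hb2 : b ≠ a₂) (hb3 : b ≠ a₃) :
    HCov p ends o a₁ a₂ a₃ b :=
  (HCov_swap p ends o a₁ a₂ a₃ b).1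
    (HCov_root_leaf_at_mark p hp hends hleaf hy ho h2 h3 hb h23 ho2 ho3 hob hb2 hb3)

end Roots

section OB

variable {V : Type*} {E : Type*} [Fintype E] [DecidableEq E] [Fintype V] [DecidableEq V]
  {R : Type*} [Field R] [LinearOrder R] [IsStrictOrderedRing R]

omit [Fintype V] in
/-- **`o` a leaf at a mark `y ∈ {a₁, a₂, a₃, b}`**: (HCOV) outright. -/
theorem HCov_o_leaf_at_mark (p : E → R) (hp : IsProbVec p) {ends : E → Sym2 V} {f : E}
    {o a₁ a₂ a₃ b y : V} (hf : ends f = s(o, y)) (hleaf : ∀ e, o ∈ ends e → e = f)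
    (hy : y = a₁ ∨ y = a₂ ∨ y = a₃ ∨ y = b) (ho1 : o ≠ a₁) (ho2 : o ≠ a₂) (ho3 : o ≠ a₃)
    (hob : o ≠ b) : HCov p ends o a₁ a₂ a₃ b := by
  rcases hy with rfl | rfl | rfl | rfl
  · unfold HCov
    rw [RootCoincidence.Gc_o_leaf_at_root p ends hf hleaf ho1 ho2 ho3 hob]
  · unfold HCov
    rw [← Gc_swap, RootCoincidence.Gc_o_leaf_at_root p ends hf hleaf ho2 ho1 ho3 hob]
  · unfold HCov
    rw [LeafLinearity.Gc_leaf_o p ends hf hleaf ho3 ho1 ho2 ho3 hob, A3Coincidence.Gc_a3_eq_o, mul_zero]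
  · exact PendantOB.HCov_pendant_o_at_b p hp ends hf hleaf hob ho1 ho2 ho3

/-- **`b` a leaf at a mark `y ∈ {a₁, a₂, a₃, o}`**: (HCOV) outright. -/
theorem HCov_b_leaf_at_mark (p : E → R) (hp : IsProbVec p) {ends : E → Sym2 V} {f : E}
    {o a₁ a₂ a₃ b y : V} (hf : ends f = s(b, y)) (hleaf : ∀ e, b ∈ ends e → e = f)
    (hy : y = a₁ ∨ y = a₂ ∨ y = a₃ ∨ y = o) (hbo : b ≠ o) (hb1 : b ≠ a₁) (hb2 : b ≠ a₂)
    (hb3 : b ≠ a₃) : HCov p ends o a₁ a₂ a₃ b := by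
  rcases hy with rfl | rfl | rfl | rfl
  · unfold HCov
    rw [RootCoincidence.Gc_b_leaf_at_root p ends hf hleaf hb1 hbo hb2 hb3]
  · unfold HCov
    rw [← Gc_swap, RootCoincidence.Gc_b_leaf_at_root p ends hf hleaf hb2 hbo hb1 hb3]
  · exact DiagBA3.HCov_pendant_b_at_a3 p hp ends hf hleaf hb3 hbo hb1 hb2
  · exact PendantBO.HCov_pendant_b_at_o p hp ends hf hleaf hbo hb1 hb2 hb3

end OB

section Classes

variable {V : Type*} {E : Type*} [DecidableEq V]

/-- `m` is a (genuine) leaf at `y` through its only edge `e`. -/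
def IsLeafAt (ends : E → Sym2 V) (m y : V) (e : E) : Prop :=
  ends e = s(m, y) ∧ m ≠ y ∧ ∀ f, m ∈ ends f → f = e

/-- **The class `NoLeafMark`**: none of the marks `a₁, a₂, o, b` is a leaf (at any vertex). -/
def NoLeafMark (ends : E → Sym2 V) (o a₁ a₂ b : V) : Prop :=
  ∀ (e : E) (y : V), ¬ IsLeafAt ends a₁ y e ∧ ¬ IsLeafAt ends a₂ y e ∧ ¬ IsLeafAt ends o y e ∧
    ¬ IsLeafAt ends b y e

omit [DecidableEq V] in
/-- A vertex is a mark or unmarked. -/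
lemma mark_or_unmarked (o a₁ a₂ a₃ b y : V) :
    (y = o ∨ y = a₁ ∨ y = a₂ ∨ y = a₃ ∨ y = b) ∨ Unmarked o a₁ a₂ a₃ b y := by
  by_cases h : y = o ∨ y = a₁ ∨ y = a₂ ∨ y = a₃ ∨ y = b
  · exact Or.inl h
  · push Not at h
    exact Or.inr ⟨h.1, h.2.1, h.2.2.1, h.2.2.2.1, h.2.2.2.2⟩

end Classes

section Closure

variable (R : Type*) [Field R] [LinearOrder R] [IsStrictOrderedRing R]

/-- **(HCOV) on the class `NoLeafMark`**. -/
def HCovNLM_all : Prop :=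
  ∀ (V E : Type) [Fintype V] [DecidableEq V] [Fintype E] [DecidableEq E]
    (ends : E → Sym2 V) (p : E → R), IsProbVec p →
    ∀ o a₁ a₂ a₃ b : V, a₁ ≠ a₂ → a₁ ≠ a₃ → a₂ ≠ a₃ → o ≠ a₁ → o ≠ a₂ → o ≠ a₃ → o ≠ b →
      b ≠ a₁ → b ≠ a₂ → b ≠ a₃ → NoLeafMark ends o a₁ a₂ b → HCov p ends o a₁ a₂ a₃ b

end Closure

section Main

variable {R : Type*} [Field R] [LinearOrder R] [IsStrictOrderedRing R]

/-- **Any of `a₁, a₂, o, b` a leaf at a MARK gives (HCOV) outright.** -/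
theorem HCov_leaf_at_mark {V E : Type*} [Fintype V] [DecidableEq V] [Fintype E] [DecidableEq E]
    (p : E → R) (hp : IsProbVec p) (ends : E → Sym2 V) {o a₁ a₂ a₃ b : V} (h12 : a₁ ≠ a₂)
    (h13 : a₁ ≠ a₃) (h23 : a₂ ≠ a₃) (ho1 : o ≠ a₁) (ho2 : o ≠ a₂) (ho3 : o ≠ a₃) (hob : o ≠ b)
    (hb1 : b ≠ a₁) (hb2 : b ≠ a₂) (hb3 : b ≠ a₃) {e : E} {y : V}
    (hy : y = o ∨ y = a₁ ∨ y = a₂ ∨ y = a₃ ∨ y = b)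
    (h : IsLeafAt ends a₁ y e ∨ IsLeafAt ends a₂ y e ∨ IsLeafAt ends o y e ∨ IsLeafAt ends b y e) :
    HCov p ends o a₁ a₂ a₃ b := by
  rcases h with ⟨he, hne, hleaf⟩ | ⟨he, hne, hleaf⟩ | ⟨he, hne, hleaf⟩ | ⟨he, hne, hleaf⟩
  · -- `a₁` a leaf at the mark `y ≠ a₁`
    have hy' : y = o ∨ y = a₂ ∨ y = a₃ ∨ y = b := by
      rcases hy with h | h | h | h | h
      · exact Or.inl h
      · exact absurd h.symm hne
      · exact Or.inr (Or.inl h)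
      · exact Or.inr (Or.inr (Or.inl h))
      · exact Or.inr (Or.inr (Or.inr h))
    exact HCov_root_leaf_at_mark' p hp he hleaf hy' ho1 h12.symm h13.symm hb1 h23 ho2 ho3 hob hb2 hb3
  · -- `a₂` a leaf at the mark `y ≠ a₂`
    have hy' : y = o ∨ y = a₁ ∨ y = a₃ ∨ y = b := by
      rcases hy with h | h | h | h | h
      · exact Or.inl h
      · exact Or.inr (Or.inl h)
      · exact absurd h.symm hne
      · exact Or.inr (Or.inr (Or.inl h))
      · exact Or.inr (Or.inr (Or.inr h))
    exact HCov_root_leaf_at_mark p hp he hleaf hy' ho2 h12 h23.symm hb2 h13 ho1 ho3 hob hb1 hb3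
  · -- `o` a leaf at the mark `y ≠ o`
    have hy' : y = a₁ ∨ y = a₂ ∨ y = a₃ ∨ y = b := by
      rcases hy with h | h | h | h | h
      · exact absurd h.symm hne
      · exact Or.inl h
      · exact Or.inr (Or.inl h)
      · exact Or.inr (Or.inr (Or.inl h))
      · exact Or.inr (Or.inr (Or.inr h))
    exact HCov_o_leaf_at_mark p hp he hleaf hy' ho1 ho2 ho3 hob
  · -- `b` a leaf at the mark `y ≠ b`
    have hy' : y = a₁ ∨ y = a₂ ∨ y = a₃ ∨ y = o := by
      rcases hy with h | h | h | h | h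
      · exact Or.inr (Or.inr (Or.inr h))
      · exact Or.inl h
      · exact Or.inr (Or.inl h)
      · exact Or.inr (Or.inr (Or.inl h))
      · exact absurd h.symm hne
    exact HCov_b_leaf_at_mark p hp he hleaf hy' hob.symm hb1 hb2 hb3

/-- (HCOV) on the class `NoUnmarkedLeaf` from (HCOV) on the smaller class `NoLeafMark`: a leaf among
`a₁, a₂, o, b` at a MARK is (HCOV) outright. -/
theorem HCovNL4_all_of_HCovNLM_all (hB : HCovNLM_all R) : HCovNL4_all R := by
  intro V E _ _ _ _ ends p hp o a₁ a₂ a₃ b h12 h13 h23 ho1 ho2 ho3 hob hb1 hb2 hb3 hNL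
  by_cases hleaf : ∃ (e : E) (y : V), IsLeafAt ends a₁ y e ∨ IsLeafAt ends a₂ y e ∨
      IsLeafAt ends o y e ∨ IsLeafAt ends b y e
  · obtain ⟨e, y, h⟩ := hleaf
    rcases mark_or_unmarked o a₁ a₂ a₃ b y with hy | hy
    · exact HCov_leaf_at_mark p hp ends h12 h13 h23 ho1 ho2 ho3 hob hb1 hb2 hb3 hy h
    · -- a leaf at an unmarked vertex contradicts `NoUnmarkedLeaf`
      exfalso
      obtain ⟨n1, n2, n3, n4⟩ := hNL e y hy
      rcases h with ⟨he, _, hl⟩ | ⟨he, _, hl⟩ | ⟨he, _, hl⟩ | ⟨he, _, hl⟩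
      · exact n1 ⟨he, hl⟩
      · exact n2 ⟨he, hl⟩
      · exact n3 ⟨he, hl⟩
      · exact n4 ⟨he, hl⟩
  · apply hB V E ends p hp o a₁ a₂ a₃ b h12 h13 h23 ho1 ho2 ho3 hob hb1 hb2 hb3
    intro e y
    push Not at hleaf
    exact hleaf e y

/-- **THE LEAF REDUCTION OF (HCOV), FINAL FORM**: `HCovNLM_all → HCov_all` — (HCOV) for every finite
weighted graph follows from (HCOV) on the graphs in which none of `a₁, a₂, o, b` is a leaf. -/
theorem HCov_all_of_noLeafMark (hB : HCovNLM_all R) : HCov_all R :=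
  HCov_all_of_noUnmarkedLeaf (HCovNL4_all_of_HCovNLM_all hB)

end Main

end LeafMarkAny

end Summit.Ventures.PercRepro2
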